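import Literature.AlgebraicTopology.CharacteristicClasses.LineEulerClass
import HarnessLib

/-!
# Classes on `P(λ ⊕ ℂ)` over a base with two contractible charts are multiples of the Thom class

J. Milnor, J. Stasheff, *Characteristic Classes* (1974), §10 (Thm. 10.4, uniqueness) and §12
(Gysin sequence: `H²` of the Thom space of a line bundle over `S²` is generated by the Thom
class): for a complex line bundle `λ` over a base `B = U₁ ∪ U₂` covered by two TRIVIALISING sets
with `H²(Uᵢ; R) = 0`, `Uᵢ` path connected and `U₁ ∩ U₂ ≠ ∅` — e.g. `ℂP¹ = ℂ ∪ (ℂP¹ ∖ 0)` —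
**every class `x ∈ H²(P(λ ⊕ ℂ); R)` killed by the section at infinity is a multiple `t(k)` of the
Thom class** (`exists_eq_thomClass_of_two_charts`):

* over `Uᵢ`, `P(λ ⊕ ℂ)|_{Uᵢ} ≅ Uᵢ × ℙ(ℂ ⊕ ℂ)` and `H²(Uᵢ × ℙ(ℂ ⊕ ℂ)) = H²(Uᵢ) ⊕ H⁰(Uᵢ)·ω`
  (`SphereLikeProductCohomology.sphereMap_bijective`), so `x|` is a local Thom class `t_{Uᵢ}(kᵢ)`
  with `kᵢ ∈ R = H⁰(Uᵢ)` (`exists_eq_localThomClass`);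
* comparing fibre restrictions at a common point, `k₁ = k₂ =: k` (`omegaFib_injective`);
* then `x` is a Thom class with generator `k` (fibre restrictions `ω_b(k)` everywhere, `s_∞^* x = 0`),
  hence `x = t(k)` by uniqueness (`IsThomClass.eq_thomClass`);

and the Thom and Euler classes are linear in the generator (`thomClass_eq_smul`,
`eulerClass_eq_smul`). Also: `H⁰` of a path-connected space consists of the constant classes
(`exists_eq_constClass`).

Everything is proved; no named facts.

## References

* J. Milnor, J. Stasheff, *Characteristic Classes*, PUP 1974, §10 Thm. 10.4, §12 Thm. 12.2. [MilnorStasheff1974]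
* A. Hatcher, *Algebraic Topology*, CUP 2002, §3.1 p. 199 (`H⁰` of a path-connected space). [HatcherAT2002]
-/

noncomputable section

open CategoryTheory CategoryTheory.Limits Function Set Bundle Literature.AlgebraicTopology.SingularHomology
open scoped LinearAlgebra.Projectivization

universe u

namespace Literature.AlgebraicTopology.SingularHomology

/-- The constant class is the class of the constant cocycle made with Mathlib's `cyclesMk`. [folklore] -/
theorem constClass_eq_π {R : Type u} [CommRing R] (M : Type u) [AddCommGroup M] [Module R M]
    (X : Type u) [TopologicalSpace X] (m : M) :
    constClass M X m = singularCohomology.π R M X 0 (singularCochainComplex.cocyclesMk (constCochain R M X m)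
      (singularCochainComplex.d_const_eq_zero m)) := by
  change singularCohomology.π R M X 0 _ = singularCohomology.π R M X 0 _
  congr 1
  apply (ModuleCat.mono_iff_injective (singularCochainComplex.iCocycles R M X 0)).1 inferInstance
  rw [singularCochainComplex.iCocycles_mk]
  erw [ShortComplex.moduleCatCyclesIso_inv_iCycles_apply]
  rfl

/-- **On a path-connected space every class of `H⁰(X; M)` is a constant class** (Hatcher §3.1 p. 199,
`H⁰(X; G) = G`; the tree's `singularCohomologyZeroEquiv`). [cite: HatcherAT2002, §3.1 p. 199] -/
theorem exists_eq_constClass {R : Type u} [CommRing R] (M : Type u) [AddCommGroup M] [Module R M]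
    {X : Type u} [TopologicalSpace X] [PathConnectedSpace X] (c : singularCohomology R M X 0) :
    ∃ m : M, c = constClass M X m := by
  refine ⟨singularCohomologyZeroEquiv R M X c, ?_⟩
  apply (singularCohomologyZeroEquiv R M X).injective
  rw [constClass_eq_π, singularCohomologyZeroEquiv_π, singularCochainComplex.cocyclesZeroEquiv_apply,
    singularCochainComplex.iCocycles_mk]

end Literature.AlgebraicTopology.SingularHomology

namespace Literature.AlgebraicTopology.CharacteristicClasses

variable {B : Type u} [TopologicalSpace B] (F : Type u) [NormedAddCommGroup F] [NormedSpace ℂ F] [FiniteDimensional ℂ F]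
  (E : B → Type u) [∀ b, AddCommGroup (E b)] [∀ b, Module ℂ (E b)]
  [TopologicalSpace (TotalSpace F E)] [∀ b, TopologicalSpace (E b)] [FiberBundle F E] [VectorBundle ℂ F E]
  (hF : Module.finrank ℂ F = 1) (R : Type u) [CommRing R] (M : Type u) [AddCommGroup M] [Module R M]

omit [FiniteDimensional ℂ F] in
/-- **`m ↦ ω_b(m)` is injective** (indeed bijective onto `H²` of the fibre): `ω_b` is the transport of
the model generator family, which is bijective (`omegaFibre_bijective`). [folklore] -/
theorem omegaFib_injective (b : B) : Injective (omegaFib F E hF R M b) := by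
  intro m m' h
  have hinj : Injective (singularCohomology.map R M
      (projProd (ULift.{u} ℂ) ((linEquivAt ℂ F E (trivializationAt F E b) b).trans (stdEquiv F hF))) 2) :=
    ((forget (ModuleCat R)).mapIso (singularCohomology.mapIso R M (homeomorphOfContinuousLinearEquiv
      ((((linEquivAt ℂ F E (trivializationAt F E b) b).trans (stdEquiv F hF))).prodCongr
        (ContinuousLinearEquiv.refl ℂ ℂ))) 2)).toEquiv.injective
  exact ((modelSphereLike (ULift.{u} ℂ) finrank_model).omegaFibre_bijective R M).1 (hinj h)

omit [FiniteDimensional ℂ F] in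
/-- `ω_b` is linear: `ω_b(r • m) = r • ω_b(m)`. [folklore] -/
theorem omegaFib_smul (b : B) (r : R) (m : M) : omegaFib F E hF R M b (r • m) = r • omegaFib F E hF R M b m := by
  rw [omegaFib, omegaFib, ← map_smul]
  exact congrArg _ ((modelSphereLike (ULift.{u} ℂ) finrank_model).omegaFibre_smul R M r m)

variable (e : Trivialization F (π F E)) [MemTrivializationAtlas e]

/-- **Over a trivialising `S` with `H²(S; R) = 0` and `S` path connected, every class of
`H²(P(λ ⊕ ℂ)|_S; R)` is a local Thom class `t_S(k)`**: `H²(S × ℙ(ℂ ⊕ ℂ)) = H²(S) ⊕ H⁰(S)·ω = R·ω`.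
[cite: MilnorStasheff1974, §12 Thm. 12.2] -/
theorem exists_eq_localThomClass {S : Set B} (hS : S ⊆ e.baseSet) [PathConnectedSpace ↥S]
    (hZ : IsZero (singularCohomology R R ↥S 2)) (z : singularCohomology R R ↥(complPreimage F E S) 2) :
    ∃ k : R, z = localThomClass hF R R e hS k := by
  set h := stdLocalHomeomorph hF e hS with hh
  set y := singularCohomology.map R R (h.symm : C(↥S × ℙ ℂ (ULift.{u} ℂ × ℂ), ↥(complPreimage F E S))) 2 z with hy
  obtain ⟨⟨y', c⟩, hyc⟩ := (modelSphereLike (ULift.{u} ℂ) finrank_model).sphereMap_surjective R R (U := ↥S) 0 y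
  have hy' : y' = 0 := (ModuleCat.subsingleton_of_isZero hZ).elim _ _
  obtain ⟨k, hk⟩ := exists_eq_constClass R c
  refine ⟨k, ?_⟩
  have hz : z = singularCohomology.map R R (h : C(↥(complPreimage F E S), ↥S × ℙ ℂ (ULift.{u} ℂ × ℂ))) 2 y := by
    rw [hy, ← ModuleCat.comp_apply, ← singularCohomology.map_comp, Homeomorph.symm_comp_toContinuousMap,
      singularCohomology.map_id]
    rfl
  rw [hz, ← hyc, hy', hk]
  rfl

section TwoCharts

variable [T2Space B] [ParacompactSpace B]
variable (e₁ e₂ : Trivialization F (π F E)) [MemTrivializationAtlas e₁] [MemTrivializationAtlas e₂]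

/-- **Over a base covered by two trivialising, path-connected, meeting sets with `H² = 0`, every class
of `H²(P(λ ⊕ ℂ); R)` killed by the section at infinity is a multiple `t(k)` of the Thom class**
(Milnor–Stasheff: by the Gysin sequence `H²` of the Thom space of a line bundle over such a base is
`R · t`). [cite: MilnorStasheff1974, §12 Thm. 12.2] -/
theorem exists_eq_thomClass_of_two_charts {U₁ U₂ : Set B} (h₁ : U₁ ⊆ e₁.baseSet) (h₂ : U₂ ⊆ e₂.baseSet)
    (hU : U₁ ∪ U₂ = univ) [PathConnectedSpace ↥U₁] [PathConnectedSpace ↥U₂] (hne : (U₁ ∩ U₂).Nonempty)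
    (hZ₁ : IsZero (singularCohomology R R ↥U₁ 2)) (hZ₂ : IsZero (singularCohomology R R ↥U₂ 2))
    (x : singularCohomology R R (ProjCompl F E) 2) (hx : singularCohomology.map R R (complInf F E hF) 2 x = 0) :
    ∃ k : R, x = thomClass F E hF R k := by
  -- local Thom classes over the two charts
  obtain ⟨k₁, hk₁⟩ := exists_eq_localThomClass F E hF R e₁ h₁ hZ₁
    (singularCohomology.map R R (subsetIncl (complPreimage F E U₁)) 2 x)
  obtain ⟨k₂, hk₂⟩ := exists_eq_localThomClass F E hF R e₂ h₂ hZ₂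
    (singularCohomology.map R R (subsetIncl (complPreimage F E U₂)) 2 x)
  -- fibre restrictions
  have hfib₁ : ∀ b (hb : b ∈ U₁), singularCohomology.map R R (complFibreIncl F E b) 2 x = omegaFib F E hF R R b k₁ := by
    intro b hb
    rw [← subsetIncl_comp_complFibOn F E hb, singularCohomology.map_comp, ModuleCat.comp_apply, hk₁]
    exact (isNormalised_localThomClass hF e₁ h₁ k₁).map_complFibOn b hb
  have hfib₂ : ∀ b (hb : b ∈ U₂), singularCohomology.map R R (complFibreIncl F E b) 2 x = omegaFib F E hF R R b k₂ := by
    intro b hb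
    rw [← subsetIncl_comp_complFibOn F E hb, singularCohomology.map_comp, ModuleCat.comp_apply, hk₂]
    exact (isNormalised_localThomClass hF e₂ h₂ k₂).map_complFibOn b hb
  -- the two generators agree
  obtain ⟨b₀, hb₁, hb₂⟩ := hne
  have hk : k₁ = k₂ := omegaFib_injective F E hF R R b₀ ((hfib₁ b₀ hb₁).symm.trans (hfib₂ b₀ hb₂))
  -- `x` is a Thom class with generator `k₁`
  refine ⟨k₁, IsThomClass.eq_thomClass hF ⟨hx, fun b ↦ ?_⟩⟩
  rcases (hU.symm ▸ mem_univ b : b ∈ U₁ ∪ U₂) with hb | hb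
  · exact hfib₁ b hb
  · rw [hfib₂ b hb, hk]

/-- **The Thom class is linear in the generator: `t(r • m) = r • t(m)`.** [cite: MilnorStasheff1974, §10 Thm. 10.4] -/
theorem thomClass_smul (r m : R) : thomClass F E hF R (r • m) = r • thomClass F E hF R m := by
  refine (IsThomClass.eq_thomClass hF (t := r • thomClass F E hF R m) ⟨?_, fun b ↦ ?_⟩).symm
  · rw [map_smul, (isThomClass_thomClass F E hF R m).map_complInf, smul_zero]
  · rw [map_smul, (isThomClass_thomClass F E hF R m).map_complFibreIncl, omegaFib_smul]

/-- `t(k) = k • t(1)`. [folklore] -/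
theorem thomClass_eq_smul (k : R) : thomClass F E hF R k = k • thomClass F E hF R 1 := by
  rw [← thomClass_smul, smul_eq_mul, mul_one]

/-- **The Euler class is linear in the generator: `e(k) = k • e(1)`.** [folklore] -/
theorem eulerClass_eq_smul (k : R) : eulerClass F E hF R k = k • eulerClass F E hF R 1 := by
  rw [eulerClass, eulerClass, thomClass_eq_smul, map_smul]

end TwoCharts

end Literature.AlgebraicTopology.CharacteristicClasses
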